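import Mathlib
import Literature.NumberTheory.Transcendental.ZagierDilogarithmConjecture
import Literature.NumberTheory.Transcendental.BlochWignerDilogarithmVolumeProofs
import Summits.KontsevichZagierPeriods.KontsevichZagierPeriods.Theses.HyperbolicBloch
import Summits.KontsevichZagierPeriods.KontsevichZagierPeriods.Theorems.HyperbolicBlochZagierDilogarithmConjectureStubTwoSaturation
import Summits.KontsevichZagierPeriods.KontsevichZagierPeriods.Theorems.HyperbolicBlochZagierDilogarithmConjectureStubKummerDescent
import Summits.KontsevichZagierPeriods.KontsevichZagierPeriods.Theorems.ZagierDilogarithmConjecture.Negative.Mirror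
import HarnessLib

/-!
# The Kummer–Clausen transfer: `ZagierDilogarithmConjecture` ⇔ its unit-circle (Clausen) form

Line `kummer-clausen-linearisation` for the crux `ZagierDilogarithmConjecture`
(stmt-KontsevichZagierPeriods-10550, route `HyperbolicBloch`), assembled from its two landed stubs
`stub_twoSaturation` (2-saturation of `⟨dilogRelators⟩` in `ℤ[ℂ]`, unique 2-divisibility of
`𝒫(ℚ̄)`) and `stub_kummerDescent` (2-saturation + Clausen form ⇒ conjecture, Kummer's relation).

`zagierDilogarithmConjecture_iff_clausenForm` (= the registered sub-goal `stub_transferIff`): the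
route decl — Zagier's dilogarithm conjecture in volume / `ℤ`-form (Neumann 1998 §2.1) — is
EQUIVALENT to its restriction to algebraic points of MODULUS ONE in the upper half plane, where
`D(e^{iθ}) = Cl₂(θ) = Im Li₂(e^{iθ})` carries no `log·arg` term (Kummer / Lobachevsky / Kubert
form, Zagier 2007 Ch. I §3; at roots of unity it is Milnor's conjecture, Milnor 1982). The one
remaining stub of the line, `stub_clausenForm`, is exactly the right-hand side: the open core, of
the same strength as the crux. Nothing here is conditional. (`crux_iff`, the unfolding of the
route decl to `ZagierDilogarithmRelationsConjecture`, is reused from `Negative/Mirror.lean`.)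
-/

noncomputable section

open scoped BigOperators
open Literature.NumberTheory.Transcendental

namespace Summit.KontsevichZagierPeriods.HyperbolicBloch.ZagierDilogarithm

open Summit.KontsevichZagierPeriods.KontsevichZagierPeriods.Theses.HyperbolicBloch
  (ZagierDilogarithmConjecture)
open Summit.KontsevichZagierPeriods.HyperbolicBloch.ZagierDilogarithmConjectureNegative (crux_iff)

/-- The trivial direction of the transfer: Zagier's conjecture implies its Clausen (unit-circle)
form, by the Bloch–Wigner reading `vol T(z) = D(z)` of the conjecture
(`ZagierDilogarithmRelationsConjecture.iff_blochWignerDilog'`, proved in the tree) — simply forget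
the hypothesis `‖uᵢ‖ = 1`. [folklore] -/
theorem clausenForm_of_relationsConjecture (h : ZagierDilogarithmRelationsConjecture) :
    ∀ (k : ℕ) (u : Fin k → ℂ) (m : Fin k → ℤ), (∀ i, IsAlgebraic ℚ (u i)) →
      (∀ i, 0 < (u i).im) → (∀ i, ‖u i‖ = 1) →
      ∑ i, (m i : ℝ) * blochWignerDilog (u i) = 0 →
        (∑ i, m i • FreeAbelianGroup.of (u i)) ∈ AddSubgroup.closure dilogRelators :=
  fun k u m hu him _ hsum =>
    (ZagierDilogarithmRelationsConjecture.iff_blochWignerDilog'.1 h) k u m hu him hsum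

/-- **The Kummer–Clausen transfer (line `kummer-clausen-linearisation`).** Zagier's dilogarithm
conjecture (the route decl `ZagierDilogarithmConjecture`, volume / `ℤ`-form) is EQUIVALENT to its
Clausen form: for algebraic `u₁, …, u_k` of modulus one in the upper half plane and integers `mⱼ`,
`Σ mⱼ D(uⱼ) = 0` implies `Σ mⱼ[uⱼ] ∈ ⟨dilogRelators⟩`. (`⇒` is restriction; `⇐` is Kummer's relation
`2[z] ≡ [z/z̄] + [(1−z⁻¹)/(1−z̄⁻¹)] + [(1−z̄)/(1−z)]` inside the relator group, `stub_kummerDescent`,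
followed by division by `2`, `stub_twoSaturation` — unique 2-divisibility of `𝒫(ℚ̄)`.)
[cite: Zagier2007Dilogarithm, Ch. I §3] -/
theorem zagierDilogarithmConjecture_iff_clausenForm :
    ZagierDilogarithmConjecture ↔
      ∀ (k : ℕ) (u : Fin k → ℂ) (m : Fin k → ℤ), (∀ i, IsAlgebraic ℚ (u i)) →
        (∀ i, 0 < (u i).im) → (∀ i, ‖u i‖ = 1) →
        ∑ i, (m i : ℝ) * blochWignerDilog (u i) = 0 →
          (∑ i, m i • FreeAbelianGroup.of (u i)) ∈ AddSubgroup.closure dilogRelators := by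
  rw [crux_iff]
  exact ⟨clausenForm_of_relationsConjecture, stub_kummerDescent stub_twoSaturation⟩

/-- **Registered sub-goal `stub_transferIff` of the crux (line `kummer-clausen-linearisation`):**
the transfer equivalence with the crux named in full — `ZagierDilogarithmConjecture` ⇔ its Clausen
(unit-circle) form. [cite: Zagier2007Dilogarithm, Ch. I §3] -/
theorem stub_transferIff :
    Summit.KontsevichZagierPeriods.KontsevichZagierPeriods.Theses.HyperbolicBloch.ZagierDilogarithmConjecture ↔
      ∀ (k : ℕ) (u : Fin k → ℂ) (m : Fin k → ℤ), (∀ i, IsAlgebraic ℚ (u i)) →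
        (∀ i, 0 < (u i).im) → (∀ i, ‖u i‖ = 1) →
        ∑ i, (m i : ℝ) * blochWignerDilog (u i) = 0 →
          (∑ i, m i • FreeAbelianGroup.of (u i)) ∈ AddSubgroup.closure dilogRelators :=
  zagierDilogarithmConjecture_iff_clausenForm

end Summit.KontsevichZagierPeriods.HyperbolicBloch.ZagierDilogarithm

end
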